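import Literature.Geometry.Riemannian.GeodesicConvexity
import Literature.Geometry.Riemannian.CartanHadamardConjugate
import Literature.Geometry.Riemannian.ExponentialMapProofs
import HarnessLib

/-!
# Radial geodesics from an interior point and the exit time through a convex level

Support file for the discharge of
`Literature.Geometry.Riemannian.ggsu_boundary_sphere_of_nonTrapping_of_nonpos`
(`SimpleAHBoundarySphere.lean`). Setting: a smooth Riemannian metric `g` (boundaryless model `I`,
Hausdorff `M`) with geodesically complete Levi-Civita connection, a base point `p`, a smooth
function `φ` satisfying the convexity hypothesis below `c₀` (`GeodesicConvexity.lean`), a level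
`c < min c₀ (φ p)`, and the non-trapping hypothesis that every radial geodesic from `p` eventually
stays in `{φ < c}`. For `u ≠ 0` the **exit time** `T(u)` — the first parameter at which
`t ↦ φ (exp_p (t u))` drops below `c` — is positive, is the unique non-negative solution of
`φ (exp_p (t u)) = c`, the radial function is `≥ c` before and `< c` after it, the crossing is
transversal, `T(λ u) = T(u)/λ`, and `T` is `C^∞` on `E ∖ {0}` (implicit function theorem, as in
Paternain–Salo–Uhlmann 2023, Lemma 3.2.3). No named facts.

## References

* G. P. Paternain, M. Salo, G. Uhlmann, *Geometric Inverse Problems*, CUP 2023, Def. 3.1.1 and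
  Lemma 3.2.3 (exit time and its regularity). [PaternainSaloUhlmann2023]
* J. M. Lee, *Introduction to Riemannian Manifolds*, 2nd ed. (2018), Prop. 5.19 (the exponential
  map). [LeeRiemannianManifolds2018]
-/

noncomputable section

open Bundle Set Function Filter Metric
open scoped Manifold ContDiff Topology

namespace Literature.Geometry.Riemannian.GGSU

open Literature.Geometry.Lorentzian
open Literature.Geometry.Lorentzian.PseudoRiemannianMetric

universe u

variable {E : Type u} [NormedAddCommGroup E] [NormedSpace ℝ E] {H : Type*} [TopologicalSpace H]
  {I : ModelWithCorners ℝ E H} {M : Type*} [TopologicalSpace M] [ChartedSpace H M]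
  [IsManifold I ∞ M] [FiniteDimensional ℝ E] [CompleteSpace E]

/-! ### The radial exponential map `u ↦ exp_p(u)` on the model space -/

section Rexp

variable (g : PseudoRiemannianMetric I ∞ E (TangentSpace I : M → Type _)) [g.HasLeviCivita]

/-- The exponential map of the Levi-Civita connection of `g` at `p`, as a map on the model vector
space `E = T_pM`. [cite: LeeRiemannianManifolds2018, p. 127 (definition of exp_p)] -/
def rexp (p : M) (u : E) : M := expMap g.leviCivita p (show TangentSpace I p from u)

variable {g}

omit [CompleteSpace E] in
/-- Unfolding of `rexp`. [folklore] -/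
theorem rexp_apply (p : M) (u : E) :
    rexp g p u = expMap g.leviCivita p (show TangentSpace I p from u) := rfl

/-- The Levi-Civita connection of a smooth metric is `C¹` (instance form). [folklore] -/
theorem contMDiffCovariantDerivative_leviCivita_one :
    CovariantDerivative.ContMDiffCovariantDerivative g.leviCivita 1 :=
  contMDiffCovariantDerivative_leviCivita_of_two_le g (WithTop.coe_le_coe.2 le_top)

/-- The Levi-Civita connection of a smooth metric is `C^∞` (instance form). [folklore] -/
theorem contMDiffCovariantDerivative_leviCivita_infty :
    CovariantDerivative.ContMDiffCovariantDerivative g.leviCivita ∞ :=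
  ⟨g.isLocallyContMDiff_leviCivita_holds ⊤ (le_refl _) univ isOpen_univ⟩

variable [T2Space M] [I.Boundaryless] (hc : IsGeodesicallyComplete g.leviCivita)
include hc

/-- `exp_p(t u) = γ_u(t)`, the maximal geodesic with initial velocity `u`.
[cite: LeeRiemannianManifolds2018, Prop. 5.19 (b)] -/
theorem rexp_smul (p : M) (u : E) (t : ℝ) :
    rexp g p (t • u) = maximalGeodesic g.leviCivita p (show TangentSpace I p from u) t := by
  haveI := contMDiffCovariantDerivative_leviCivita_one (g := g)
  exact expMap_smul hc p (show TangentSpace I p from u) t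

/-- The radial curve `t ↦ exp_p(t u)` is the maximal geodesic `γ_u`. [cite: LeeRiemannianManifolds2018, Prop. 5.19 (b)] -/
theorem rexp_line_eq (p : M) (u : E) :
    (fun t : ℝ ↦ rexp g p (t • u)) = maximalGeodesic g.leviCivita p (show TangentSpace I p from u) :=
  funext fun t ↦ rexp_smul hc p u t

/-- The radial curve `t ↦ exp_p(t u)` is an entire geodesic through `p` with initial velocity `u`.
[cite: LeeRiemannianManifolds2018, Cor. 4.28 and Prop. 5.19 (b)] -/
theorem isGeodesic_rexp_line (p : M) (u : E) :
    IsGeodesic g.leviCivita (fun t : ℝ ↦ rexp g p (t • u)) ∧ rexp g p ((0 : ℝ) • u) = p ∧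
      velocity I (fun t : ℝ ↦ rexp g p (t • u)) 0 = u := by
  haveI := contMDiffCovariantDerivative_leviCivita_one (g := g)
  obtain ⟨-, hgeo, h0, hv0⟩ :=
    maximalGeodesic_of_isGeodesicallyComplete hc p (show TangentSpace I p from u)
  refine ⟨?_, ?_, ?_⟩
  · rw [rexp_line_eq hc]; exact hgeo
  · rw [rexp_smul hc]; exact h0
  · rw [rexp_line_eq hc]; exact hv0

/-- `exp_p(0) = p`. [cite: LeeRiemannianManifolds2018, Prop. 5.19] -/
theorem rexp_zero (p : M) : rexp g p (0 : E) = p := by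
  have h := (isGeodesic_rexp_line hc p (0 : E)).2.1
  rwa [zero_smul] at h

/-- `exp_p` is `C^∞` on `E`. [cite: LeeRiemannianManifolds2018, Prop. 5.19 (a)] -/
theorem contMDiff_rexp (p : M) : ContMDiff 𝓘(ℝ, E) I ∞ (rexp g p) := by
  haveI := contMDiffCovariantDerivative_leviCivita_one (g := g)
  haveI := contMDiffCovariantDerivative_leviCivita_infty (g := g)
  exact contMDiff_expMap_infty hc p

/-- `exp_p` is continuous. [folklore] -/
theorem continuous_rexp (p : M) : Continuous (rexp g p) := (contMDiff_rexp hc p).continuous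

/-- **Nonpositive curvature: `exp_p` is a local diffeomorphism on all of `E`**
(`CartanHadamard.isLocalDiffeomorph_expMap`). [cite: Lee2018, Thm. 12.8 (proof, p. 357)] -/
theorem isLocalDiffeomorph_rexp (hg : g.IsRiemannian)
    (hsec : ∀ (x : M) (X Y : TangentSpace I x), g.curvatureForm g.leviCivita x X Y Y X ≤ 0)
    (p : M) : IsLocalDiffeomorph 𝓘(ℝ, E) I ∞ (rexp g p) := by
  haveI := contMDiffCovariantDerivative_leviCivita_one (g := g)
  haveI := contMDiffCovariantDerivative_leviCivita_infty (g := g)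
  exact CartanHadamard.isLocalDiffeomorph_expMap hg hsec
    (g.isLocallyContMDiff_leviCivita_holds 1 (by exact_mod_cast le_top)) hc p

/-- `(t, u) ↦ φ (exp_p (t u))` is `C^∞` on `ℝ × E` for smooth `φ`. [folklore] -/
theorem contDiff_comp_rexp_smul (p : M) {φ : M → ℝ} (hφ : CMDiff ∞ φ) :
    ContDiff ℝ ∞ fun q : ℝ × E ↦ φ (rexp g p (q.1 • q.2)) := by
  have h1 : ContMDiff 𝓘(ℝ, ℝ × E) 𝓘(ℝ, E) ∞ (fun q : ℝ × E ↦ q.1 • q.2) :=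
    contMDiff_iff_contDiff.2 (contDiff_fst.smul contDiff_snd)
  have h2 : ContMDiff 𝓘(ℝ, ℝ × E) 𝓘(ℝ, ℝ) ∞ (fun q : ℝ × E ↦ φ (rexp g p (q.1 • q.2))) :=
    hφ.comp ((contMDiff_rexp hc p).comp h1)
  exact contMDiff_iff_contDiff.1 h2

/-- `t ↦ φ (exp_p (t u))` is continuous. [folklore] -/
theorem continuous_comp_rexp_line (p : M) {φ : M → ℝ} (hφ : CMDiff ∞ φ) (u : E) :
    Continuous fun t : ℝ ↦ φ (rexp g p (t • u)) :=
  hφ.continuous.comp ((continuous_rexp hc p).comp (continuous_id.smul continuous_const))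

end Rexp

/-! ### The exit time through the level `c` -/

section ExitTime

variable (g : PseudoRiemannianMetric I ∞ E (TangentSpace I : M → Type _)) [g.HasLeviCivita]

/-- The **exit time** of the radial geodesic `t ↦ exp_p(t u)` through the level `c` of `φ`: the
infimum of the non-negative parameters at which `φ (exp_p (t u)) < c` (Paternain–Salo–Uhlmann's
`τ(x, v)` for the domain `{φ ≥ c}`; junk `0 = sInf ∅` if the geodesic never enters `{φ < c}`).
[cite: PaternainSaloUhlmann2023, Def. 3.1.1] -/
def exitTime (p : M) (φ : M → ℝ) (c : ℝ) (u : E) : ℝ :=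
  sInf {t : ℝ | 0 ≤ t ∧ φ (rexp g p (t • u)) < c}

variable {g} [T2Space M] [I.Boundaryless] {φ : M → ℝ} {c₀ c : ℝ} {p : M}

/-- The defining set of the exit time is non-empty (non-trapping) and bounded below by `0`, and the
exit time is positive: `φ (exp_p (t u)) > c` for small `t ≥ 0` since `φ p > c`.
[cite: PaternainSaloUhlmann2023, Def. 3.1.1] -/
theorem exitTime_pos (hc : IsGeodesicallyComplete g.leviCivita) (hφ : CMDiff ∞ φ) (hcp : c < φ p)
    (hNT : ∀ u : E, u ≠ 0 → ∃ T : ℝ, ∀ t, T ≤ t → φ (rexp g p (t • u)) < c)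
    {u : E} (hu : u ≠ 0) :
    0 < exitTime g p φ c u ∧ (∀ t, 0 ≤ t → t < exitTime g p φ c u → c ≤ φ (rexp g p (t • u))) ∧
      {t : ℝ | 0 ≤ t ∧ φ (rexp g p (t • u)) < c}.Nonempty := by
  set S := {t : ℝ | 0 ≤ t ∧ φ (rexp g p (t • u)) < c} with hS
  have hbdd : BddBelow S := ⟨0, fun t ht ↦ ht.1⟩
  obtain ⟨T₀, hT₀⟩ := hNT u hu
  have hne : S.Nonempty := ⟨max T₀ 0, le_max_right _ _, hT₀ _ (le_max_left _ _)⟩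
  have hcont := continuous_comp_rexp_line hc p hφ u
  -- `φ (exp (t u)) > c` near `t = 0`
  have h0 : c < φ (rexp g p ((0 : ℝ) • u)) := by rw [zero_smul, rexp_zero hc]; exact hcp
  have hev : ∀ᶠ t in 𝓝 (0 : ℝ), c < φ (rexp g p (t • u)) :=
    hcont.continuousAt.eventually (lt_mem_nhds h0)
  obtain ⟨ε, hε, hball⟩ := Metric.eventually_nhds_iff.1 hev
  have hlow : ∀ t ∈ S, ε ≤ t := by
    intro t ht
    by_contra hlt
    push Not at hlt
    have : c < φ (rexp g p (t • u)) := hball (by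
      rw [Real.dist_eq, sub_zero, abs_of_nonneg ht.1]; exact hlt)
    exact absurd ht.2 (not_lt.2 this.le)
  have hpos : 0 < exitTime g p φ c u := lt_of_lt_of_le hε (le_csInf hne hlow)
  refine ⟨hpos, fun t ht0 ht ↦ ?_, hne⟩
  by_contra hlt
  push Not at hlt
  have : exitTime g p φ c u ≤ t := csInf_le hbdd ⟨ht0, hlt⟩
  exact absurd ht (not_lt.2 this)

/-- At the exit time the radial function takes the value `c`. [cite: PaternainSaloUhlmann2023, Def. 3.1.1] -/
theorem apply_exitTime (hc : IsGeodesicallyComplete g.leviCivita) (hφ : CMDiff ∞ φ) (hcp : c < φ p)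
    (hNT : ∀ u : E, u ≠ 0 → ∃ T : ℝ, ∀ t, T ≤ t → φ (rexp g p (t • u)) < c)
    {u : E} (hu : u ≠ 0) : φ (rexp g p (exitTime g p φ c u • u)) = c := by
  obtain ⟨hpos, hbefore, hne⟩ := exitTime_pos hc hφ hcp hNT hu
  set T := exitTime g p φ c u with hT
  have hcont := continuous_comp_rexp_line hc p hφ u
  have hbdd : BddBelow {t : ℝ | 0 ≤ t ∧ φ (rexp g p (t • u)) < c} := ⟨0, fun t ht ↦ ht.1⟩
  apply le_antisymm
  · -- `T` is in the closure of the defining set, where `φ ∘ exp ≤ c`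
    have hmem : T ∈ closure {t : ℝ | 0 ≤ t ∧ φ (rexp g p (t • u)) < c} := csInf_mem_closure hne hbdd
    have hcl : closure {t : ℝ | 0 ≤ t ∧ φ (rexp g p (t • u)) < c} ⊆
        {t : ℝ | φ (rexp g p (t • u)) ≤ c} := by
      refine closure_minimal (fun t ht ↦ ht.2.le) ?_
      exact isClosed_le hcont continuous_const
    exact hcl hmem
  · -- from the left, `φ ∘ exp ≥ c`
    have hT' : Tendsto (fun t : ℝ ↦ φ (rexp g p (t • u))) (𝓝[<] T) (𝓝 (φ (rexp g p (T • u)))) :=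
      hcont.continuousAt.continuousWithinAt.tendsto
    refine ge_of_tendsto hT' ?_
    filter_upwards [Ioo_mem_nhdsLT hpos] with t ht
    exact hbefore t ht.1.le ht.2

/-- **Before the exit time the radial function is `≥ c`** (on `[0, T(u)]`). [cite: PaternainSaloUhlmann2023, Def. 3.1.1] -/
theorem le_apply_of_le_exitTime (hc : IsGeodesicallyComplete g.leviCivita) (hφ : CMDiff ∞ φ) (hcp : c < φ p)
    (hNT : ∀ u : E, u ≠ 0 → ∃ T : ℝ, ∀ t, T ≤ t → φ (rexp g p (t • u)) < c)
    {u : E} (hu : u ≠ 0) {t : ℝ} (ht0 : 0 ≤ t)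
    (ht : t ≤ exitTime g p φ c u) : c ≤ φ (rexp g p (t • u)) := by
  rcases ht.lt_or_eq with hlt | heq
  · exact (exitTime_pos hc hφ hcp hNT hu).2.1 t ht0 hlt
  · rw [heq, apply_exitTime hc hφ hcp hNT hu]

/-- **After the exit time the radial function is `< c`**: a later parameter with value `≥ c`
together with `T(u)` would bound a dip of `φ ∘ γ_u` below `c`, excluded by convexity
(`le_comp_geodesic_of_endpoints`). [cite: PaternainSaloUhlmann2023, Lemma 3.1.12] -/
theorem apply_lt_of_exitTime_lt (hg : g.IsRiemannian) (hc : IsGeodesicallyComplete g.leviCivita) (hφ : CMDiff ∞ φ)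
    (hcvx : ∀ x, φ x < c₀ → mvfderiv I φ x ≠ 0 ∧
      ∀ u : TangentSpace I x, u ≠ 0 → mvfderiv I φ x u = 0 → g.hessian φ x u u < 0)
    (hcc₀ : c < c₀) (hcp : c < φ p)
    (hNT : ∀ u : E, u ≠ 0 → ∃ T : ℝ, ∀ t, T ≤ t → φ (rexp g p (t • u)) < c)
    {u : E} (hu : u ≠ 0) {t : ℝ} (ht : exitTime g p φ c u < t) :
    φ (rexp g p (t • u)) < c := by
  obtain ⟨hpos, hbefore, hne⟩ := exitTime_pos hc hφ hcp hNT hu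
  set T := exitTime g p φ c u with hT
  have hbdd : BddBelow {t : ℝ | 0 ≤ t ∧ φ (rexp g p (t • u)) < c} := ⟨0, fun t ht ↦ ht.1⟩
  by_contra hge
  push Not at hge
  -- some `s ∈ (T, t)` has `φ (exp (s u)) < c`
  obtain ⟨s, hsS, hst⟩ : ∃ s ∈ {t : ℝ | 0 ≤ t ∧ φ (rexp g p (t • u)) < c}, s < t := by
    by_contra hno
    push Not at hno
    have : t ≤ T := le_csInf hne fun s hs ↦ hno s hs
    exact absurd ht (not_lt.2 this)
  have hTs : T < s := by
    rcases lt_or_ge T s with h | h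
    · exact h
    · exfalso
      rcases h.lt_or_eq with h' | h'
      · exact absurd hsS.2 (not_lt.2 (hbefore s hsS.1 h'))
      · rw [h', hT] at hsS
        have h2 := hsS.2
        rw [apply_exitTime hc hφ hcp hNT hu] at h2
        exact lt_irrefl _ h2
  -- no dip on `[T, t]`
  obtain ⟨hgeo, -, hv0⟩ := isGeodesic_rexp_line hc p u
  have hvel : velocity I (fun t : ℝ ↦ rexp g p (t • u)) 0 ≠ 0 := by rw [hv0]; exact hu
  have hdip := le_comp_geodesic_of_endpoints hg hφ hcvx hgeo hvel hcc₀
    (by rw [hT, apply_exitTime hc hφ hcp hNT hu]) hge s ⟨hTs.le, hst.le⟩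
  exact absurd hsS.2 (not_lt.2 hdip)

/-- **Uniqueness of the crossing**: the only non-negative solution of `φ (exp_p (t u)) = c` is the
exit time (a smaller solution would be an interior local minimum of `φ ∘ γ_u` with value
`c < c₀`). [cite: PaternainSaloUhlmann2023, Lemma 3.1.12] -/
theorem eq_exitTime_of_apply_eq (hg : g.IsRiemannian) (hc : IsGeodesicallyComplete g.leviCivita) (hφ : CMDiff ∞ φ)
    (hcvx : ∀ x, φ x < c₀ → mvfderiv I φ x ≠ 0 ∧
      ∀ u : TangentSpace I x, u ≠ 0 → mvfderiv I φ x u = 0 → g.hessian φ x u u < 0)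
    (hcc₀ : c < c₀) (hcp : c < φ p)
    (hNT : ∀ u : E, u ≠ 0 → ∃ T : ℝ, ∀ t, T ≤ t → φ (rexp g p (t • u)) < c)
    {u : E} (hu : u ≠ 0) {t : ℝ} (ht0 : 0 ≤ t)
    (ht : φ (rexp g p (t • u)) = c) : t = exitTime g p φ c u := by
  obtain ⟨hpos, hbefore, -⟩ := exitTime_pos hc hφ hcp hNT hu
  set T := exitTime g p φ c u with hT
  rcases lt_trichotomy t T with hlt | heq | hgt
  · exfalso
    -- `t` is a local minimum of `φ ∘ γ_u` with value `c`
    have ht_pos : 0 < t := by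
      rcases ht0.lt_or_eq with h | h
      · exact h
      · exfalso
        rw [← h, zero_smul, rexp_zero hc] at ht
        exact absurd hcp (by rw [ht]; exact lt_irrefl c)
    obtain ⟨hgeo, -, hv0⟩ := isGeodesic_rexp_line hc p u
    have hvel : velocity I (fun t : ℝ ↦ rexp g p (t • u)) 0 ≠ 0 := by rw [hv0]; exact hu
    have hmin : IsLocalMin (fun s : ℝ ↦ φ (rexp g p (s • u))) t := by
      have hnhds : Icc 0 T ∈ 𝓝 t := Icc_mem_nhds ht_pos hlt
      filter_upwards [hnhds] with s hs
      rw [ht]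
      exact le_apply_of_le_exitTime hc hφ hcp hNT hu hs.1 hs.2
    exact not_isLocalMin_comp_geodesic hg hφ hcvx hgeo hvel (by rw [ht]; exact hcc₀) hmin
  · exact heq
  · exfalso
    have := apply_lt_of_exitTime_lt hg hc hφ hcvx hcc₀ hcp hNT hu hgt
    rw [ht] at this
    exact lt_irrefl _ this

/-- **Homogeneity**: `T(λ u) = T(u) / λ` for `λ > 0` (`exp_p (t (λ u)) = exp_p ((t λ) u)`).
[cite: PaternainSaloUhlmann2023, Def. 3.1.1] -/
theorem exitTime_smul (hg : g.IsRiemannian) (hc : IsGeodesicallyComplete g.leviCivita) (hφ : CMDiff ∞ φ)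
    (hcvx : ∀ x, φ x < c₀ → mvfderiv I φ x ≠ 0 ∧
      ∀ u : TangentSpace I x, u ≠ 0 → mvfderiv I φ x u = 0 → g.hessian φ x u u < 0)
    (hcc₀ : c < c₀) (hcp : c < φ p)
    (hNT : ∀ u : E, u ≠ 0 → ∃ T : ℝ, ∀ t, T ≤ t → φ (rexp g p (t • u)) < c)
    {u : E} (hu : u ≠ 0) {l : ℝ} (hl : 0 < l) :
    exitTime g p φ c (l • u) = exitTime g p φ c u / l := by
  have hlu : l • u ≠ 0 := smul_ne_zero hl.ne' hu
  symm
  refine eq_exitTime_of_apply_eq hg hc hφ hcvx hcc₀ hcp hNT hlu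
    (div_nonneg (exitTime_pos hc hφ hcp hNT hu).1.le hl.le) ?_
  rw [smul_smul, div_mul_cancel₀ _ hl.ne']
  exact apply_exitTime hc hφ hcp hNT hu

/-- **The crossing is transversal**: `(d/dt) φ (exp_p (t u)) < 0` at `t = T(u)`
(`mvfderiv_velocity_neg_of_exit_level`). [cite: PaternainSaloUhlmann2023, Lemma 3.2.3 (proof)] -/
theorem mvfderiv_velocity_exitTime_neg (hg : g.IsRiemannian) (hc : IsGeodesicallyComplete g.leviCivita) (hφ : CMDiff ∞ φ)
    (hcvx : ∀ x, φ x < c₀ → mvfderiv I φ x ≠ 0 ∧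
      ∀ u : TangentSpace I x, u ≠ 0 → mvfderiv I φ x u = 0 → g.hessian φ x u u < 0)
    (hcc₀ : c < c₀) (hcp : c < φ p)
    (hNT : ∀ u : E, u ≠ 0 → ∃ T : ℝ, ∀ t, T ≤ t → φ (rexp g p (t • u)) < c)
    {u : E} (hu : u ≠ 0) :
    mvfderiv I φ (rexp g p (exitTime g p φ c u • u))
      (velocity I (fun t : ℝ ↦ rexp g p (t • u)) (exitTime g p φ c u)) < 0 := by
  obtain ⟨hgeo, -, hv0⟩ := isGeodesic_rexp_line hc p u
  have hvel : velocity I (fun t : ℝ ↦ rexp g p (t • u)) 0 ≠ 0 := by rw [hv0]; exact hu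
  exact mvfderiv_velocity_neg_of_exit_level hg hφ hcvx hgeo hvel
    (exitTime_pos hc hφ hcp hNT hu).1 hcc₀
    (fun t ht ↦ le_apply_of_le_exitTime hc hφ hcp hNT hu ht.1 ht.2)
    (apply_exitTime hc hφ hcp hNT hu)

end ExitTime


/-! ### Smoothness of the exit time (implicit function theorem) -/

section Smooth

universe u'

variable {E : Type u'} [NormedAddCommGroup E] [NormedSpace ℝ E] {H : Type*} [TopologicalSpace H]
  {I : ModelWithCorners ℝ E H} {M : Type*} [TopologicalSpace M] [ChartedSpace H M]
  [IsManifold I ∞ M] [FiniteDimensional ℝ E] [CompleteSpace E]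
  {g : PseudoRiemannianMetric I ∞ E (TangentSpace I : M → Type _)} [g.HasLeviCivita]
  [T2Space M] [I.Boundaryless] {φ : M → ℝ} {c₀ c : ℝ} {p : M}

/-- The derivative of `t ↦ φ (exp_p (t u))` is `dφ(γ_u'(t))`. [folklore] -/
theorem hasDerivAt_comp_rexp_line (hc : IsGeodesicallyComplete g.leviCivita) (hφ : CMDiff ∞ φ)
    (u : E) (t : ℝ) :
    HasDerivAt (fun t : ℝ ↦ φ (rexp g p (t • u)))
      (mvfderiv I φ (rexp g p (t • u)) (velocity I (fun t : ℝ ↦ rexp g p (t • u)) t)) t := by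
  obtain ⟨hgeo, -, -⟩ := isGeodesic_rexp_line hc p u
  exact hasDerivAt_comp_curve_mvfderiv ((hφ _).mdifferentiableAt (by simp))
    (IsGeodesicOn.mdifferentiableAt_holds hgeo (mem_univ t))

/-- The partial derivative of `(t, u) ↦ φ (exp_p (t u))` in the direction `(1, 0)` is the time
derivative `dφ(γ_u'(t))`. [folklore] -/
theorem fderiv_comp_rexp_smul_apply_one_zero (hc : IsGeodesicallyComplete g.leviCivita)
    (hφ : CMDiff ∞ φ) (q : ℝ × E) :
    fderiv ℝ (fun q : ℝ × E ↦ φ (rexp g p (q.1 • q.2))) q (1, 0) =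
      mvfderiv I φ (rexp g p (q.1 • q.2)) (velocity I (fun t : ℝ ↦ rexp g p (t • q.2)) q.1) := by
  set G : ℝ × E → ℝ := fun q ↦ φ (rexp g p (q.1 • q.2)) with hG_def
  have hGs : ContDiff ℝ ∞ G := contDiff_comp_rexp_smul hc p hφ
  have h1 : HasFDerivAt G (fderiv ℝ G q) q := (hGs.differentiable (by simp) q).hasFDerivAt
  have h2 : HasDerivAt (fun t : ℝ ↦ ((t, q.2) : ℝ × E)) ((1 : ℝ), (0 : E)) q.1 :=
    (hasDerivAt_id q.1).prodMk (hasDerivAt_const q.1 q.2)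
  have h3 : HasDerivAt (fun t ↦ G (t, q.2)) (fderiv ℝ G q (1, 0)) q.1 :=
    h1.comp_hasDerivAt_of_eq q.1 h2 (by simp)
  exact h3.unique (hasDerivAt_comp_rexp_line hc hφ q.2 q.1)

/-- **The exit time is `C^∞` on `E ∖ {0}`** (Paternain–Salo–Uhlmann 2023, Lemma 3.2.3, by the
implicit function theorem): the map `F(t, u) = (φ (exp_p (t u)), u)` of `ℝ × E` is `C^∞` with
invertible differential at `(T(u₀), u₀)` (transversality of the crossing), its local inverse sends
`(c, v)` to a pair `(θ v, v)` with `φ (exp_p (θ(v) v)) = c` and `θ v > 0`, so `θ v = T v` by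
uniqueness of the crossing, and `T` is `C^∞` at `u₀`. [cite: PaternainSaloUhlmann2023, Lemma 3.2.3] -/
theorem contDiffAt_exitTime (hg : g.IsRiemannian) (hc : IsGeodesicallyComplete g.leviCivita)
    (hφ : CMDiff ∞ φ)
    (hcvx : ∀ x, φ x < c₀ → mvfderiv I φ x ≠ 0 ∧
      ∀ u : TangentSpace I x, u ≠ 0 → mvfderiv I φ x u = 0 → g.hessian φ x u u < 0)
    (hcc₀ : c < c₀) (hcp : c < φ p)
    (hNT : ∀ u : E, u ≠ 0 → ∃ T : ℝ, ∀ t, T ≤ t → φ (rexp g p (t • u)) < c)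
    {u₀ : E} (hu₀ : u₀ ≠ 0) : ContDiffAt ℝ ∞ (exitTime g p φ c) u₀ := by
  set T : E → ℝ := exitTime g p φ c with hT_def
  set G : ℝ × E → ℝ := fun q ↦ φ (rexp g p (q.1 • q.2)) with hG_def
  have hGs : ContDiff ℝ ∞ G := contDiff_comp_rexp_smul hc p hφ
  -- the map `F (t, u) = (G (t, u), u)` and its differential at `p₀ = (T u₀, u₀)`
  set F : ℝ × E → ℝ × E := fun q ↦ (G q, q.2) with hF_def
  have hFs : ContDiff ℝ ∞ F := hGs.prodMk contDiff_snd
  set p₀ : ℝ × E := (T u₀, u₀) with hp₀_def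
  set G' : ℝ × E →L[ℝ] ℝ := fderiv ℝ G p₀ with hG'_def
  have hG' : HasFDerivAt G G' p₀ := (hGs.differentiable (by simp) p₀).hasFDerivAt
  set B : ℝ × E →L[ℝ] ℝ × E := G'.prod (ContinuousLinearMap.snd ℝ ℝ E) with hB_def
  have hB : HasFDerivAt F B p₀ := hG'.prodMk hasFDerivAt_snd
  -- `∂_t G (p₀) < 0`
  have hneg : G' ((1 : ℝ), (0 : E)) < 0 := by
    rw [hG'_def, fderiv_comp_rexp_smul_apply_one_zero hc hφ p₀]
    exact mvfderiv_velocity_exitTime_neg hg hc hφ hcvx hcc₀ hcp hNT hu₀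
  -- the kernel of `B` is trivial, so `B` is invertible
  have hBker : ∀ w : ℝ × E, B w = 0 → w = 0 := by
    rintro ⟨a, w⟩ hw
    have hw' : (G' (a, w), w) = 0 := by simpa [hB_def] using hw
    have hw0 : w = 0 := (Prod.mk_eq_zero.1 hw').2
    have ha : G' (a, w) = 0 := (Prod.mk_eq_zero.1 hw').1
    rw [hw0] at ha
    have hsm : ((a, (0 : E)) : ℝ × E) = a • ((1 : ℝ), (0 : E)) := by simp
    rw [hsm, map_smul, smul_eq_mul] at ha
    rcases mul_eq_zero.1 ha with h | h
    · rw [h, hw0]; rfl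
    · exact absurd h hneg.ne
  have hBinj : Injective (B : ℝ × E →ₗ[ℝ] ℝ × E) := by
    intro w₁ w₂ h
    have h' : B (w₁ - w₂) = 0 := by
      have h'' : B w₁ = B w₂ := h
      rw [map_sub, h'', sub_self]
    exact sub_eq_zero.1 (hBker _ h')
  have hker : LinearMap.ker (B : ℝ × E →ₗ[ℝ] ℝ × E) = ⊥ := LinearMap.ker_eq_bot.2 hBinj
  have hrange : LinearMap.range (B : ℝ × E →ₗ[ℝ] ℝ × E) = ⊤ :=
    LinearMap.range_eq_top.2 ((B : ℝ × E →ₗ[ℝ] ℝ × E).injective_iff_surjective.1 hBinj)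
  set A : (ℝ × E) ≃L[ℝ] (ℝ × E) := ContinuousLinearEquiv.ofBijective B hker hrange with hA_def
  have hA : HasFDerivAt F (A : ℝ × E →L[ℝ] ℝ × E) p₀ := by
    rw [hA_def, ContinuousLinearEquiv.coe_ofBijective]
    exact hB
  -- inverse function theorem
  have hFp₀ : ContDiffAt ℝ ∞ F p₀ := hFs.contDiffAt
  set e := hFp₀.toOpenPartialHomeomorph F hA (by simp) with he_def
  have he_coe : (e : ℝ × E → ℝ × E) = F := rfl
  have hp₀e : p₀ ∈ e.source := hFp₀.mem_toOpenPartialHomeomorph_source hA (by simp)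
  have hinv : ContDiffAt ℝ ∞ e.symm (F p₀) := hFp₀.to_localInverse hA (by simp)
  have hFp₀c : F p₀ = (c, u₀) := by
    simp only [hF_def, hG_def, hp₀_def, Prod.mk.injEq, and_true]
    exact apply_exitTime hc hφ hcp hNT hu₀
  have htgt : F p₀ ∈ e.target := by rw [← he_coe]; exact e.map_source hp₀e
  -- for `v` near `u₀`: `(c, v) ∈ e.target`, `θ v := (e.symm (c, v)).1 > 0` and `θ v = T v`
  set θ : E → ℝ := fun v ↦ (e.symm ((c, v) : ℝ × E)).1 with hθ_def
  have hpair : Continuous (fun v : E ↦ ((c, v) : ℝ × E)) := continuous_const.prodMk continuous_id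
  have hev_tgt : ∀ᶠ v in 𝓝 u₀, ((c, v) : ℝ × E) ∈ e.target := by
    refine hpair.continuousAt.preimage_mem_nhds (e.open_target.mem_nhds ?_)
    rw [← hFp₀c]; exact htgt
  have hθc : ContinuousAt θ u₀ := by
    have h2 : ContinuousAt e.symm (((c : ℝ), u₀) : ℝ × E) := by
      rw [← hFp₀c]; exact hinv.continuousAt
    exact continuousAt_fst.comp (h2.comp hpair.continuousAt)
  have hθu₀ : θ u₀ = T u₀ := by
    show (e.symm ((c, u₀) : ℝ × E)).1 = T u₀
    rw [← hFp₀c, ← he_coe, e.left_inv hp₀e]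
  have hev_pos : ∀ᶠ v in 𝓝 u₀, 0 < θ v := by
    refine hθc.eventually (lt_mem_nhds ?_)
    rw [hθu₀]; exact (exitTime_pos hc hφ hcp hNT hu₀).1
  have hev_ne : ∀ᶠ v in 𝓝 u₀, v ≠ (0 : E) := isOpen_ne.eventually_mem hu₀
  have hev : θ =ᶠ[𝓝 u₀] T := by
    filter_upwards [hev_tgt, hev_pos, hev_ne] with v hv hvpos hv0
    have h1 : F (e.symm ((c, v) : ℝ × E)) = (c, v) := by rw [← he_coe]; exact e.right_inv hv
    have h2 : (e.symm ((c, v) : ℝ × E)).2 = v := by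
      have := congrArg Prod.snd h1
      simpa [hF_def] using this
    have h3 : G (e.symm ((c, v) : ℝ × E)) = c := by
      have := congrArg Prod.fst h1
      simpa [hF_def] using this
    have h4 : φ (rexp g p (θ v • v)) = c := by
      rw [hθ_def]
      have : G ((e.symm ((c, v) : ℝ × E)).1, (e.symm ((c, v) : ℝ × E)).2) = c := h3
      rw [h2] at this
      exact this
    exact eq_exitTime_of_apply_eq hg hc hφ hcvx hcc₀ hcp hNT hv0 hvpos.le h4
  -- conclude
  have hcomp : ContDiffAt ℝ ∞ θ u₀ := by
    have h1 : ContDiffAt ℝ ∞ (fun v : E ↦ (((c : ℝ), v) : ℝ × E)) u₀ :=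
      contDiffAt_const.prodMk contDiffAt_id
    have h2 : ContDiffAt ℝ ∞ e.symm (((c : ℝ), u₀) : ℝ × E) := by rw [← hFp₀c]; exact hinv
    exact contDiffAt_fst.comp u₀ (h2.comp u₀ h1)
  exact hcomp.congr_of_eventuallyEq hev.symm

end Smooth

end Literature.Geometry.Riemannian.GGSU
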